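import Literature.Analysis.FluidPDE.SuitableWeak
import HarnessLib

/-!
# Named fact: the decay estimate for the pressure of a distributional Navier–Stokes solution,
`D(ϱ) ≤ c [(ϱ/r) D(r) + (r/ϱ)² C(r)]` (Seregin–Šverák 2009, (as13); Seregin 2005, (p9)–(p12))

Analysis/FluidPDE fact file (D-0014 named fact, nothing asserted). It serves the decomposition of
`Literature.Analysis.FluidPDE.rusin_sverak_leray_singular_points_stable` (Rusin–Šverák 2011,
Thm. 4.2 with Lemma 2.1; files `RusinSverakLeraySolutions.lean`, `RusinSverakLerayStability.lean`),
whose two local ingredients — the stability of singularities (Lemma 2.1,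
`rusin_sverak_stability_of_singularities`) and the backward-cylinder regularity bridge
(`isRegularPoint_of_eLpNorm_parabolicCylinder_lt_top`) — both rest on the classical treatment of
the pressure near a point where the velocity is under control: "The pressure `p^k` solves the
equation `-Δp^k = ∂ᵢ∂ⱼ(uᵢ^k uⱼ^k)` [...] decompose `p^k` as `p^k = p̃^k + h^k` with `p̃^k` [...]
(by Calderon–Zygmund estimates) and `h^k` [...] harmonic in `x` [...]. The term `h^k` is handled by
using classical estimates for harmonic functions" (Rusin–Šverák, arXiv:0911.0500 p. 4, proof of
Lemma 2.1). In the scale-invariant quantities of Caffarelli–Kohn–Nirenberg / Lin / Seregin,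

  `C(z, r) = r⁻² ∫∫_{Q_r(z)} |u|³`,  `D(z, r) = r⁻² ∫∫_{Q_r(z)} |p|^{3/2}`

(the accepted `cknC`, `cknD` of `SuitableWeak.lean`, backward cylinders
`Q_r(t, x) = (t - r², t) × B_r(x)`), this treatment is the **decay estimate for the pressure**

  `D(z, ϱ) ≤ c [ (ϱ/r) D(z, r) + (r/ϱ)² C(z, r) ]`,  `0 < ϱ ≤ r`,          (∗)

with a universal constant `c`. The printed sources and what exactly they print:

* G. Seregin, V. Šverák, Comm. PDE 34 (2009) = arXiv:0804.1803, proof of Lemma 3.5, display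
  (as13) (arXiv p. 10): "and the decay estimate for the pressure field
  `D(z_b, ϱ; q) ≤ c [ (ϱ/r) D(z_b, r; q) + (r/ϱ)² C(z_b, r; v) ]`. Here, `z_b` and `r` satisfy
  conditions (as5) and `0 < ϱ ≤ r`" — invoked, next to the local energy inequality (as12), as a
  standard property of the (distributional, `v ∈ L₃`, `q ∈ L_{3/2}`; suitable by Remark 3.4)
  solutions at hand; there `C`, `D` are the plain quantities above (§3, arXiv p. 9; no mean is
  subtracted) but the space sections are the coordinate cylinders
  `𝒞(x₀, R) = {|x' - x₀'| < R, |x₃ - x₀₃| < R}` ("just for convenience", Seregin 2014 §6.5), and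
  the centres `z_b = (b e₃, 0)` sit at the top time of the domain `Q = 𝒞 × ]-1, 0[`, so that
  `Q(z_b, r) ⊆ Q` with a common top;
* G. Seregin, *Navier–Stokes equations: almost `L_{3,∞}`-case*, J. Math. Fluid Mech. 9 (2007) =
  arXiv:math/0510396, §2 (p9)–(p12) (arXiv p. 3), for a suitable weak solution on
  `Q = B × ]-1, 0[` (balls): "we split the pressure into two parts `p = p¹ + p²`, where `p¹` is
  determined as a unique solution of [`∫_B p¹ Δφ = -∫_B v ⊗ v : ∇²φ`, `φ|_{∂B} = 0`] [...] It is
  well known that `p¹` satisfies the estimate `∫_B |p¹(x,t)|^{3/2} dx ≤ c ∫_B |v(x,t)|³ dx` [...]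
  The second component of the pressure is a harmonic function and, therefore, satisfies the
  estimates `sup_{x ∈ B(2/3)} |p²(x,t)|^{3/2} ≤ c ∫_B |p²(x,t)|^{3/2} dx ≤
  c (∫_B |p(x,t)|^{3/2} dx + ∫_B |v(x,t)|³ dx)`" — the two ingredients of (∗) on **balls**:
  integrating (p10) in time gives `ϱ⁻² ∫∫_{Q_ϱ} |p¹|^{3/2} ≤ c (r/ϱ)² C(r)`, and (p12) rescaled
  (`sup_{B_{r/2}} |p²|^{3/2} ≤ c r⁻³ ∫_{B_r} |p²|^{3/2}`) gives, for `ϱ ≤ r/2`,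
  `ϱ⁻² ∫∫_{Q_ϱ} |p²|^{3/2} ≤ c ϱ⁻² ϱ³ r⁻³ ∫∫_{Q_r} (|p|^{3/2} + c|v|³) = c (ϱ/r) (D(r) + c C(r))`,
  while for `r/2 < ϱ ≤ r` trivially `D(ϱ) ≤ 4 D(r) ≤ 8 (ϱ/r) D(r)`; (∗) follows since
  `ϱ/r ≤ (r/ϱ)²`;
* G. Seregin, J. Math. Sci. 143 (2007) = arXiv:math/0607537, §2 "the list of the main estimates
  of suitable weak solutions", display (2.4): `D₀(r) ≤ c [ (r/ϱ)^{5/2} D₀(ϱ) + (ϱ/r)² C(ϱ) ]`,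
  `0 < r ≤ ϱ ≤ 1`, "proved in [S6]" (= Seregin, Math. Ann. 332 (2005)) — the same estimate on balls
  for the mean-free quantity `D₀(r) = r⁻² ∫∫_{Q_r} |p - [p]_{x,r}|^{3/2}`, where subtracting the
  spatial mean improves the harmonic factor from `ϱ/r` to `(ϱ/r)^{5/2}` (gradient estimate
  instead of the sup estimate; Seregin 2014, Lemma 6.4 and (6.1.43)).

**What is vendored** is (∗) itself — the plain-`D`, ball form, linear factor `ϱ/r` — i.e. the
display (as13) read with the balls of Caffarelli–Kohn–Nirenberg / Lin / Seregin 2005–2006 in place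
of Seregin–Šverák's coordinate cylinders `𝒞`; as recorded above it is the two printed lines
(p10), (p12) of Seregin 2005 integrated in time, and it is the statement Rusin–Šverák's proof of
Lemma 2.1 uses ("The term with `p̃^k` can be dealt with in the same way as the term with `u^k`.
The term `h^k` is handled by using classical estimates for harmonic functions").

Relation to the tree. (i) The axisymmetric, Type-I-context rendering of the display (as13) **with
Seregin–Šverák's own cylinders `𝒞`** is `SereginSverak2009.PressureDecay`
(`SereginSverakScaledEnergy.lean`, quantities `pressureD`, `cubicC` on `parCyl`); neither fact is a
specialisation of the other as stated (balls `B_R ⊆ 𝒞(R) ⊆ B_{√2 R}` versus coordinate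
cylinders, and that fact is stated for `IsAxisymmetricLocalSolution` at the top-time centres
`(0, b e₃)`); since both follow from the same split, the `𝒞`-form follows from the ball form at
comparable radii with a different constant (`D_𝒞(ϱ) ≤ 2 D_B(√2 ϱ)`, `C_B(r) ≤ C_𝒞(r)`) — left as
a follow-up, not needed here. (ii) The companion estimate in the `A·E` variables —
Robinson–Rodrigo–Sadowski 2016, Lemma 16.7, `D(θr) ≤ κ₅ θ^{-3/2} A(r)^{3/4} E(r)^{3/4} + κ₆ θ D(r)` —
is the accepted named fact `pressureEstimate` (`CKNEpsilonRegularityAssembly.lean`); the present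
`C`-form is the one consumed when the smallness at hand is that of `∫∫ |u|³` (strong `L³_{t,x}`
convergence, or boundedness of `u`), as in Rusin–Šverák's Lemma 2.1 and Seregin–Šverák's
Lemma 3.5.

## Rendering (design notes)

* Hypothesis: `(u, p)` is a **distributional** solution of the unforced unit-viscosity
  Navier–Stokes equations on an open `Q ⊆ ℝ × ℝ³` (`Fluid.IsDistributionalNSSolutionOn Q 1 0 u p`:
  `u, |u|², p ∈ L¹_loc(Q)`, `div u = 0` and the momentum equation in `𝒟'(Q)`), which is all the
  mechanism uses (the pressure equation `Δp = -∂ᵢ∂ⱼ(uᵢuⱼ)` in `𝒟'(Q)`, by testing with `ψ = ∇ϑ`);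
  the local energy inequality plays no role, and the integrability `u ∈ L³(Q_r(z))`,
  `p ∈ L^{3/2}(Q_r(z))` under which (∗) has content is automatic in the `ℝ≥0∞` form (if `C(r; z)`
  or `D(r; z)` is infinite, (∗) is trivially true for `c > 0`). Seregin–Šverák's standing class
  (§3: `v ∈ L₃(Q)`, `q ∈ L_{3/2}(Q)`, Navier–Stokes in `𝒟'`) and Seregin's suitable weak solutions
  are such.
* Domain: every backward cylinder **contained in `Q`**, `Q_r(z) ⊆ Q` (open inclusion): the
  printed centres `z_b = (b e₃, 0)` lie at the top time of `Q = 𝒞 × ]-1, 0[`, the estimate being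
  slice-wise in `x` for a.e. `t` of the open time interval, nothing is needed at the top time.
* The letters follow (as13): `ϱ` is the small radius, `r` the large one, `0 < ϱ ≤ r`; ratios
  enter through `ENNReal.ofReal`, the quantities are the `ℝ≥0∞`-valued `cknD`, `cknC`
  (backward cylinders over balls), the constant is `c : ℝ≥0`, universal (`∃ c` first; "we denote
  all positive universal constants by `c`", Seregin 2006 §2); `ν = 1`, `f = 0` as in all sources.
* Nothing is asserted; users take `(h : seregin_sverak_pressure_decay)`. Discharging it requires
  the `L^{3/2}` Calderón–Zygmund bound for `∂ᵢ∂ⱼΔ⁻¹` (the tree's named fact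
  `stein1970_hessian_Lp_bound`, `HessianLaplacianLp.lean`), the pressure equation in `𝒟'`
  (`DistributionalPressurePoisson.lean`, proved), Weyl's lemma and the interior sup estimate for
  harmonic functions (`HarmonicBallMeanValue.lean`).

## Mathlib / tree search

Tree: `cknC`, `cknD`, `parabolicCylinder`, `IsDistributionalNSSolutionOn` (`SuitableWeak.lean`,
`WeakSolution.lean`); `pressureEstimate` (RRS Lemma 16.7 form), `SereginSverak2009.PressureDecay`
(coordinate cylinders, axisymmetric context); nothing named `*pressure_decay*` at root
(`lean search 'pressure_decay'`). Mathlib has no Calderón–Zygmund theory at this pin.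

## References

* G. Seregin, V. Šverák, *On Type I singularities of the local axi-symmetric solutions of the
  Navier–Stokes equations*, Comm. PDE 34 (2009) 171–201 = arXiv:0804.1803: §3 p. 9 (cylinders
  `𝒞`, `Q(z₀, R)`, the quantities `A, E, C, D`), Remark 3.4, proof of Lemma 3.5, (as5),
  (as12)–(as13) (p. 10). [`SereginSverak2009`]
* G. Seregin, *Navier–Stokes equations: almost `L_{3,∞}`-case*, J. Math. Fluid Mech. 9 (2007)
  34–43 = arXiv:math/0510396, §2, (p9)–(p12) (arXiv p. 3). [`Seregin2005`]
* G. Seregin, *Regularity for suitable weak solutions to the Navier–Stokes equations in critical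
  Morrey spaces*, J. Math. Sci. 143 (2007) = arXiv:math/0607537, Def. 1.1, §2 (2.1)–(2.6).
  [`Seregin2006`]
* G. Seregin, *Lecture notes on regularity theory for the Navier–Stokes equations*, World
  Scientific (2014), Lemma 6.4, (6.1.38)–(6.1.43); §6.5 (balls vs. cylinders). [`Seregin2014`]
* W. Rusin, V. Šverák, J. Funct. Anal. 260 (2011) = arXiv:0911.0500, proof of Lemma 2.1 (p. 4).
  [`RusinSverak2011`]
* J. C. Robinson, J. L. Rodrigo, W. Sadowski, *The three-dimensional Navier–Stokes equations*,
  CUP (2016), Lemma 16.7. [`RobinsonRodrigoSadowski2016`]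
-/

noncomputable section

open MeasureTheory Set Function Filter Topology TopologicalSpace Metric
open scoped NNReal ENNReal

namespace Literature.Analysis.FluidPDE

/-- Local notation for physical space `ℝ³ = EuclideanSpace ℝ (Fin 3)`. -/
local notation "ℝ³" => EuclideanSpace ℝ (Fin 3)

/-- NAMED FACT (**decay estimate for the pressure**; Seregin–Šverák, Comm. PDE 34 (2009) =
arXiv:0804.1803, proof of Lemma 3.5, display (as13), p. 10: "and the decay estimate for the
pressure field `D(z_b, ϱ; q) ≤ c [ (ϱ/r) D(z_b, r; q) + (r/ϱ)² C(z_b, r; v) ]`. Here, `z_b` and `r`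
satisfy conditions (as5) and `0 < ϱ ≤ r`", with `C(z, r; v) = r⁻² ∫_{Q(z,r)} |v|³`,
`D(z, r; q) = r⁻² ∫_{Q(z,r)} |q|^{3/2}` (§3 p. 9, plain quantities), read — as in Caffarelli–Kohn–
Nirenberg, Lin, Rusin–Šverák and Seregin 2005–2006 — with balls `B(x, r)` as space sections in
place of Seregin–Šverák's coordinate cylinders `𝒞(x, r)`; in this ball form it is the time
integral of the two printed lines of Seregin, J. Math. Fluid Mech. 9 (2007) = arXiv:math/0510396,
§2 (p10), (p12): `∫_B |p¹|^{3/2} ≤ c ∫_B |v|³` for the Calderón–Zygmund part and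
`sup_{B(2/3)} |p²|^{3/2} ≤ c ∫_B |p²|^{3/2}` for the harmonic part of `p = p¹ + p²` (module
docstring; the mean-free variant with factor `(ϱ/r)^{5/2}` is Seregin 2006, (2.4)).
Transcription: there is a universal constant `c` such that for every distributional solution
`(u, p)` of the unforced unit-viscosity Navier–Stokes equations on an open `Q ⊆ ℝ × ℝ³`
(`IsDistributionalNSSolutionOn Q 1 0 u p`), every backward cylinder `Q_r(z) ⊆ Q` and every
`0 < ϱ ≤ r`, `D(ϱ; z) ≤ c ((ϱ/r) D(r; z) + (r/ϱ)² C(r; z))` in `ℝ≥0∞` (`D = cknD`, `C = cknC`;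
trivially true when `C(r; z)` or `D(r; z)` is infinite). Users take
`(h : seregin_sverak_pressure_decay)`.
[cite: SereginSverak2009, proof of Lemma 3.5, (as13) (arXiv:0804.1803 p. 10), ball form; Seregin2005 §2 (p10),(p12); cf. Seregin2006 §2 (2.4)] -/
def seregin_sverak_pressure_decay : Prop :=
  ∃ c : ℝ≥0, ∀ (Q : Opens (ℝ × ℝ³)) (u : ℝ → ℝ³ → ℝ³) (p : ℝ → ℝ³ → ℝ),
    IsDistributionalNSSolutionOn Q 1 0 u p →
    ∀ (z : ℝ × ℝ³) (r ϱ : ℝ), 0 < ϱ → ϱ ≤ r →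
      parabolicCylinder r z ⊆ (Q : Set (ℝ × ℝ³)) →
      cknD ϱ z p ≤
        c * (ENNReal.ofReal (ϱ / r) * cknD r z p + ENNReal.ofReal ((r / ϱ) ^ 2) * cknC r z u)

/-- **The decay estimate at ratio `θ`** (substitute `ϱ = θ r` in (as13)): under
`seregin_sverak_pressure_decay`, with its constant `c`, for `0 < θ ≤ 1` and `0 < r`,
`D(θ r; z) ≤ c (θ D(r; z) + θ⁻² C(r; z))` whenever `Q_r(z) ⊆ Q` — the form in which the
estimate is iterated along the scales `θʲ r₀` (Seregin–Šverák 2009, p. 10, "The latter inequality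
can be easily iterated"). [cite: SereginSverak2009, proof of Lemma 3.5, (as13) (arXiv:0804.1803 p. 10)] -/
theorem seregin_sverak_pressure_decay.ratio (h : seregin_sverak_pressure_decay) :
    ∃ c : ℝ≥0, ∀ (Q : Opens (ℝ × ℝ³)) (u : ℝ → ℝ³ → ℝ³) (p : ℝ → ℝ³ → ℝ),
      IsDistributionalNSSolutionOn Q 1 0 u p →
      ∀ (z : ℝ × ℝ³) (r θ : ℝ), 0 < r → 0 < θ → θ ≤ 1 →
        parabolicCylinder r z ⊆ (Q : Set (ℝ × ℝ³)) →
        cknD (θ * r) z p ≤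
          c * (ENNReal.ofReal θ * cknD r z p + ENNReal.ofReal ((θ⁻¹) ^ 2) * cknC r z u) := by
  obtain ⟨c, hc⟩ := h
  refine ⟨c, fun Q u p hs z r θ hr hθ hθ1 hsub => ?_⟩
  have key := hc Q u p hs z r (θ * r) (mul_pos hθ hr) (mul_le_of_le_one_left hr.le hθ1) hsub
  have e1 : θ * r / r = θ := by field_simp
  have e2 : r / (θ * r) = θ⁻¹ := by field_simp
  rwa [e1, e2] at key

end Literature.Analysis.FluidPDE

end
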